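import Mathlib
import Summits.AtomisticToContinuum.Crystallization.Theorems.ChessboardParticlePlanesLjLaminarWindowsGlueC5
import Summits.AtomisticToContinuum.Crystallization.Theorems.ChessboardParticlePlanesLjLaminarWindowsPathCount
import HarnessLib

/-! # Mass bound in an all-spiky region, part A — helpers of stub `stub_massBound` of line `Sketch`
(skeleton rev. 14, lead c8), crux `LjLaminarWindows` (stmt-AtomisticToContinuum-6711)

Elementary counting lemmas for Stage A of the non-spiky-fraction argument: maximal separated
sub-families cover (`massBound_cover`) and are small (`massBound_sep_card`), ring points of a
`23/20`-connected configuration (`massBound_rings`, `massBound_rings_dist`), the thick-circle bound for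
two particle shells (`massBound_pair`) and the collar inequality at a particle all of whose
`L/10`-neighbours are spiky (`massBound_collar`, Bonferroni over the ring shells). -/

noncomputable section

open scoped BigOperators
open Filter Topology
open Literature.MathematicalPhysics.StatisticalMechanics
open Summit.AtomisticToContinuum.Crystallization.Theorems.ChargedEnergyGapNegative

namespace Summit.AtomisticToContinuum.Crystallization.Theorems.LjLaminarWindowsSketch

/-- A `7/10`-separated configuration is injective. [folklore] -/
theorem massBound_injective {N : ℕ} (x : Fin N → E3)
    (hsep : ∀ j k : Fin N, j ≠ k → (7 : ℝ) / 10 ≤ dist (x j) (x k)) : Function.Injective x := by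
  intro j k hjk
  by_contra hne
  have h := hsep j k hne
  rw [hjk, dist_self] at h
  norm_num at h

/-- Packing: a family of indices whose points lie in a closed ball of radius `R'` about `c` and are
pairwise more than `r > 0` apart has at most `(2R'/r + 1)³` members
(`card_le_of_separated_of_dist_le`). [folklore] -/
theorem massBound_sep_card {N : ℕ} (x : Fin N → E3) (hx : Function.Injective x)
    (P : Finset (Fin N)) (c : E3) {r R' : ℝ} (hr : 0 < r) (hR' : 0 ≤ R')
    (hP : ∀ y ∈ P, dist (x y) c ≤ R')
    (hs : ∀ y ∈ P, ∀ y' ∈ P, y ≠ y' → r < dist (x y) (x y')) :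
    (P.card : ℝ) ≤ (2 * R' / r + 1) ^ 3 := by
  classical
  have h := card_le_of_separated_of_dist_le (P.image x) c hr hR' ?_ ?_
  · rw [finrank_euclideanSpace_fin, Finset.card_image_of_injective _ hx] at h
    exact_mod_cast h
  · intro p hp
    obtain ⟨j, hj, rfl⟩ := Finset.mem_image.1 hp
    exact hP j hj
  · intro p hp p' hp' hne
    obtain ⟨j, hj, rfl⟩ := Finset.mem_image.1 hp
    obtain ⟨k, hk, rfl⟩ := Finset.mem_image.1 hp'
    exact (hs j hj k hk fun h => hne (h ▸ rfl)).le

/-- Maximal separated sub-families cover: inside any finite family `B` of indices there is a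
sub-family `P`, pairwise more than `ρ ≥ 0` apart, such that every member of `B` is within `ρ` of a
member of `P` (a separated sub-family of maximal cardinality). [folklore] -/
theorem massBound_cover {N : ℕ} (x : Fin N → E3) (B : Finset (Fin N)) {ρ : ℝ} (hρ : 0 ≤ ρ) :
    ∃ P : Finset (Fin N), P ⊆ B ∧ (∀ y ∈ P, ∀ y' ∈ P, y ≠ y' → ρ < dist (x y) (x y')) ∧
      ∀ z ∈ B, ∃ y ∈ P, dist (x z) (x y) ≤ ρ := by
  classical
  set F : Finset (Finset (Fin N)) :=
    B.powerset.filter fun P => ∀ y ∈ P, ∀ y' ∈ P, y ≠ y' → ρ < dist (x y) (x y') with hF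
  have hF0 : (∅ : Finset (Fin N)) ∈ F := by simp [hF]
  obtain ⟨P, hPF, hmax⟩ := F.exists_max_image Finset.card ⟨∅, hF0⟩
  rw [hF, Finset.mem_filter, Finset.mem_powerset] at hPF
  refine ⟨P, hPF.1, hPF.2, fun z hz => ?_⟩
  by_contra hcon
  push Not at hcon
  have hzP : z ∉ P := fun h => by
    have h' := hcon z h
    rw [dist_self] at h'
    linarith
  have hins : insert z P ∈ F := by
    rw [hF, Finset.mem_filter, Finset.mem_powerset]
    refine ⟨Finset.insert_subset hz hPF.1, ?_⟩
    intro y hy y' hy' hne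
    rw [Finset.mem_insert] at hy hy'
    rcases hy with hyz | hy
    · rcases hy' with hy'z | hy'
      · exact absurd (hyz.trans hy'z.symm) hne
      · rw [hyz]
        exact hcon y' hy'
    · rcases hy' with hy'z | hy'
      · rw [hy'z, dist_comm]
        exact hcon y hy
      · exact hPF.2 y hy y' hy' hne
  have h := hmax _ hins
  rw [Finset.card_insert_of_notMem hzP] at h
  omega

/-- Ring points: in a `23/20`-connected configuration with a particle at distance `≥ (2m+1) D` from
`x a` (`D ≥ 23/20`), every ring `2(i+1) D ≤ |· - x a| < (2i+3) D`, `i < m`, holds a particle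
(connectivity applied to the open `2(i+1)D`-ball). [folklore] -/
theorem massBound_rings {N : ℕ} (x : Fin N → E3)
    (hconn : ∀ S : Finset (Fin N), S.Nonempty → Sᶜ.Nonempty →
      ∃ p ∈ S, ∃ k ∈ Sᶜ, dist (x p) (x k) ≤ 23 / 20)
    {D : ℝ} (hD : 23 / 20 ≤ D) (m : ℕ) (a : Fin N)
    (hfar : ∃ j : Fin N, (2 * m + 1) * D ≤ dist (x j) (x a)) :
    ∃ Q : ℕ → Fin N, ∀ i < m,
      2 * (i + 1) * D ≤ dist (x (Q i)) (x a) ∧ dist (x (Q i)) (x a) < (2 * i + 3) * D := by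
  obtain ⟨j₀, hj₀⟩ := hfar
  have hD0 : 0 < D := by linarith
  have key : ∀ i : ℕ, ∃ y : Fin N, i < m →
      2 * (i + 1) * D ≤ dist (x y) (x a) ∧ dist (x y) (x a) < (2 * i + 3) * D := by
    intro i
    by_cases hi : i < m
    · set S : Finset (Fin N) :=
        Finset.univ.filter fun y : Fin N => dist (x y) (x a) < 2 * (i + 1) * D with hS
      have haS : a ∈ S := by
        refine Finset.mem_filter.2 ⟨Finset.mem_univ _, ?_⟩
        rw [dist_self]
        positivity
      have hi' : (i : ℝ) + 1 ≤ m := by exact_mod_cast hi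
      have hj₀S : j₀ ∈ Sᶜ := by
        refine Finset.mem_compl.2 fun h => ?_
        have h' : dist (x j₀) (x a) < 2 * (i + 1) * D := (Finset.mem_filter.1 h).2
        nlinarith
      obtain ⟨p, hp, k, hk, hpk⟩ := hconn S ⟨a, haS⟩ ⟨j₀, hj₀S⟩
      have hpS : dist (x p) (x a) < 2 * (i + 1) * D := (Finset.mem_filter.1 hp).2
      have hkS : ¬ dist (x k) (x a) < 2 * (i + 1) * D := fun h =>
        (Finset.mem_compl.1 hk) (Finset.mem_filter.2 ⟨Finset.mem_univ _, h⟩)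
      refine ⟨k, fun _ => ⟨le_of_not_gt hkS, ?_⟩⟩
      calc dist (x k) (x a) ≤ dist (x k) (x p) + dist (x p) (x a) := dist_triangle _ _ _
        _ < 23 / 20 + 2 * (i + 1) * D := by rw [dist_comm]; exact add_lt_add_of_le_of_lt hpk hpS
        _ ≤ (2 * i + 3) * D := by linarith
    · exact ⟨a, fun h => absurd h hi⟩
  choose Q hQ using key
  exact ⟨Q, hQ⟩

/-- Distances of ring points: they lie within `(2m+1) D` of the centre, and two of them are at
distance in `[D, 2(2m+1)D]`. [folklore] -/
theorem massBound_rings_dist {N : ℕ} (x : Fin N → E3) {D : ℝ} (hD : 0 ≤ D) (m : ℕ) (a : Fin N)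
    (Q : ℕ → Fin N)
    (hQ : ∀ i < m, 2 * (i + 1) * D ≤ dist (x (Q i)) (x a) ∧ dist (x (Q i)) (x a) < (2 * i + 3) * D) :
    (∀ i < m, dist (x (Q i)) (x a) ≤ (2 * m + 1) * D) ∧
      ∀ i < m, ∀ j < i, D ≤ dist (x (Q i)) (x (Q j)) ∧
        dist (x (Q i)) (x (Q j)) ≤ 2 * ((2 * m + 1) * D) := by
  have hup : ∀ i < m, dist (x (Q i)) (x a) ≤ (2 * m + 1) * D := by
    intro i hi
    have hi' : (i : ℝ) + 1 ≤ m := by exact_mod_cast hi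
    have h := (hQ i hi).2
    nlinarith
  refine ⟨hup, fun i hi j hj => ⟨?_, ?_⟩⟩
  · have hj' : (j : ℝ) + 1 ≤ i := by exact_mod_cast hj
    have h1 := (hQ i hi).1
    have h2 := (hQ j (hj.trans hi)).2
    have h3 := dist_triangle (x (Q i)) (x (Q j)) (x a)
    nlinarith
  · have h1 := hup i hi
    have h2 := hup j (hj.trans hi)
    rw [dist_comm] at h2
    linarith [dist_triangle (x (Q i)) (x a) (x (Q j))]

/-- Thick-circle bound for two particle shells: if the thick-circle count `hTC` holds, two particles
`u, v` at distance in `[max(4R, D), L/2]` have at most `3·10⁴ L R² (L/D + 1)` particles in the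
intersection of their shells `L - R < |· - x u|, |· - x v| ≤ L` (take `z = x u`, `r = 2L`,
`√(LR) ≤ L`). [folklore] -/
theorem massBound_pair
    (hTC : ∀ (N : ℕ) (x : Fin N → E3), (∀ j k : Fin N, j ≠ k → (7 : ℝ) / 10 ≤ dist (x j) (x k)) →
      ∀ (L R : ℝ), 1 ≤ R → 100 * R ≤ L →
      ∀ (q q' z : E3) (r : ℝ), 4 * R ≤ dist q q' → dist q q' ≤ L / 2 → 0 ≤ r →
        ((Finset.univ.filter fun j : Fin N =>
            (L - R < dist (x j) q ∧ dist (x j) q ≤ L) ∧ (L - R < dist (x j) q' ∧ dist (x j) q' ≤ L) ∧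
              dist (x j) z ≤ r).card : ℝ) ≤
          10000 * (r + Real.sqrt (L * R)) * R ^ 2 * (L / dist q q' + 1))
    {N : ℕ} (x : Fin N → E3) (hsep : ∀ j k : Fin N, j ≠ k → (7 : ℝ) / 10 ≤ dist (x j) (x k))
    {L R D : ℝ} (hR : 1 ≤ R) (hRL : 100 * R ≤ L) (hD : 0 < D) (u v : Fin N)
    (h4 : 4 * R ≤ dist (x u) (x v)) (hDuv : D ≤ dist (x u) (x v)) (h2 : dist (x u) (x v) ≤ L / 2) :
    (((Finset.univ.filter fun q : Fin N => L - R < dist (x q) (x u) ∧ dist (x q) (x u) ≤ L) ∩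
        (Finset.univ.filter fun q : Fin N =>
          L - R < dist (x q) (x v) ∧ dist (x q) (x v) ≤ L)).card : ℝ) ≤
      30000 * L * R ^ 2 * (L / D + 1) := by
  have hL0 : 0 ≤ L := by linarith
  have h := hTC N x hsep L R hR hRL (x u) (x v) (x u) (2 * L) h4 h2 (by linarith)
  have hsub : (Finset.univ.filter fun q : Fin N => L - R < dist (x q) (x u) ∧ dist (x q) (x u) ≤ L) ∩
      (Finset.univ.filter fun q : Fin N => L - R < dist (x q) (x v) ∧ dist (x q) (x v) ≤ L) ⊆
      Finset.univ.filter fun j : Fin N =>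
        (L - R < dist (x j) (x u) ∧ dist (x j) (x u) ≤ L) ∧
          (L - R < dist (x j) (x v) ∧ dist (x j) (x v) ≤ L) ∧ dist (x j) (x u) ≤ 2 * L := by
    intro j hj
    rw [Finset.mem_inter, Finset.mem_filter, Finset.mem_filter] at hj
    exact Finset.mem_filter.2 ⟨Finset.mem_univ _, hj.1.2, hj.2.2, by linarith [hj.1.2.2]⟩
  have hsqrt : Real.sqrt (L * R) ≤ L :=
    calc Real.sqrt (L * R) ≤ Real.sqrt (L * L) := Real.sqrt_le_sqrt (by nlinarith)
      _ = L := Real.sqrt_mul_self hL0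
  have hdiv : L / dist (x u) (x v) ≤ L / D := div_le_div_of_nonneg_left hL0 hD hDuv
  calc _ ≤ ((Finset.univ.filter fun j : Fin N =>
        (L - R < dist (x j) (x u) ∧ dist (x j) (x u) ≤ L) ∧
          (L - R < dist (x j) (x v) ∧ dist (x j) (x v) ≤ L) ∧ dist (x j) (x u) ≤ 2 * L).card : ℝ) := by
        exact_mod_cast Finset.card_le_card hsub
    _ ≤ 10000 * (2 * L + Real.sqrt (L * R)) * R ^ 2 * (L / dist (x u) (x v) + 1) := h
    _ ≤ 10000 * (2 * L + L) * R ^ 2 * (L / D + 1) := by gcongr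
    _ = 30000 * L * R ^ 2 * (L / D + 1) := by ring

/-- **Collar inequality.** Let `Q 0, …, Q (m-1)` be particles within `L/10` of `x a`, each `θ`-spiky at
scale `L` (shell `(L - R, L]`), whose pairwise shell intersections hold at most `τ` particles, and let
Bonferroni's inequality `hBonf` hold.  Then `m θ · #B_{0.9L}(a) ≤ #B_{1.1L}(a) + m² τ`: each shell of
`Q i` holds more than `θ #B_L(Q i) ≥ θ #B_{0.9L}(a)` particles, all shells lie in `B_{1.1L}(a)`, and
Bonferroni bounds the sum of the shell counts by the union plus the pairwise intersections. [folklore] -/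
theorem massBound_collar :
    ∀ {N : ℕ} (x : Fin N → E3), (∀ (N' n : ℕ) (A : ℕ → Finset (Fin N')),
      ∑ i ∈ Finset.range n, ((A i).card : ℝ) ≤
        (((Finset.range n).biUnion A).card : ℝ) +
          ∑ i ∈ Finset.range n, ∑ j ∈ Finset.range i, ((A i ∩ A j).card : ℝ)) →
    ∀ {L R θ τ : ℝ}, 0 ≤ θ → 0 ≤ τ → ∀ (m : ℕ) (a : Fin N) (Q : ℕ → Fin N),
    (∀ i < m, dist (x (Q i)) (x a) ≤ L / 10) →
    (∀ i < m,
      θ * ((Finset.univ.filter fun q : Fin N => dist (x q) (x (Q i)) ≤ L).card : ℝ) <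
        ((Finset.univ.filter fun q : Fin N =>
          L - R < dist (x q) (x (Q i)) ∧ dist (x q) (x (Q i)) ≤ L).card : ℝ)) →
    (∀ i < m, ∀ j < i,
      (((Finset.univ.filter fun q : Fin N =>
          L - R < dist (x q) (x (Q i)) ∧ dist (x q) (x (Q i)) ≤ L) ∩
        (Finset.univ.filter fun q : Fin N =>
          L - R < dist (x q) (x (Q j)) ∧ dist (x q) (x (Q j)) ≤ L)).card : ℝ) ≤ τ) →
    (m : ℝ) * θ * ((Finset.univ.filter fun j : Fin N => dist (x j) (x a) ≤ 9 / 10 * L).card : ℝ) ≤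
      ((Finset.univ.filter fun j : Fin N => dist (x j) (x a) ≤ 11 / 10 * L).card : ℝ) +
        (m : ℝ) ^ 2 * τ := by
  intro N x hBonf L R θ τ hθ hτ m a Q hQa hspiky hI
  obtain ⟨A, hA⟩ : ∃ A : ℕ → Finset (Fin N), ∀ i, A i = Finset.univ.filter fun q : Fin N =>
      L - R < dist (x q) (x (Q i)) ∧ dist (x q) (x (Q i)) ≤ L := ⟨_, fun _ => rfl⟩
  simp only [← hA] at hspiky hI
  have hB := hBonf N m A
  -- the left sum dominates `m θ #B_{0.9L}(a)`
  have h1 : ∀ i ∈ Finset.range m,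
      θ * ((Finset.univ.filter fun j : Fin N => dist (x j) (x a) ≤ 9 / 10 * L).card : ℝ) ≤
        ((A i).card : ℝ) := by
    intro i hi
    have hi' := Finset.mem_range.1 hi
    have hsub : (Finset.univ.filter fun j : Fin N => dist (x j) (x a) ≤ 9 / 10 * L) ⊆
        Finset.univ.filter fun q : Fin N => dist (x q) (x (Q i)) ≤ L :=
      Finset.monotone_filter_right _ fun j _ hj => by
        linarith [dist_triangle (x j) (x a) (x (Q i)), hQa i hi', dist_comm (x a) (x (Q i))]
    have hle : ((Finset.univ.filter fun j : Fin N => dist (x j) (x a) ≤ 9 / 10 * L).card : ℝ) ≤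
        ((Finset.univ.filter fun q : Fin N => dist (x q) (x (Q i)) ≤ L).card : ℝ) := by
      exact_mod_cast Finset.card_le_card hsub
    have hs := hspiky i hi'
    nlinarith
  have hsum1 : (m : ℝ) * θ *
      ((Finset.univ.filter fun j : Fin N => dist (x j) (x a) ≤ 9 / 10 * L).card : ℝ) ≤
        ∑ i ∈ Finset.range m, ((A i).card : ℝ) := by
    have h := Finset.sum_le_sum h1
    rw [Finset.sum_const, Finset.card_range, nsmul_eq_mul] at h
    linarith
  -- the union lies in `B_{1.1L}(a)`
  have hsum2 : (((Finset.range m).biUnion A).card : ℝ) ≤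
      ((Finset.univ.filter fun j : Fin N => dist (x j) (x a) ≤ 11 / 10 * L).card : ℝ) := by
    have hsub : (Finset.range m).biUnion A ⊆
        Finset.univ.filter fun j : Fin N => dist (x j) (x a) ≤ 11 / 10 * L := by
      refine Finset.biUnion_subset.2 fun i hi => ?_
      have hi' := Finset.mem_range.1 hi
      rw [hA]
      exact Finset.monotone_filter_right _ fun j _ hj => by
        linarith [dist_triangle (x j) (x (Q i)) (x a), hQa i hi', hj.2]
    exact_mod_cast Finset.card_le_card hsub
  -- the pairwise intersections
  have hsum3 : ∑ i ∈ Finset.range m, ∑ j ∈ Finset.range i, ((A i ∩ A j).card : ℝ) ≤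
      (m : ℝ) ^ 2 * τ := by
    have h3 : ∀ i ∈ Finset.range m, ∑ j ∈ Finset.range i, ((A i ∩ A j).card : ℝ) ≤ m * τ := by
      intro i hi
      have hi' := Finset.mem_range.1 hi
      calc ∑ j ∈ Finset.range i, ((A i ∩ A j).card : ℝ) ≤ ∑ j ∈ Finset.range i, τ :=
            Finset.sum_le_sum fun j hj => hI i hi' j (Finset.mem_range.1 hj)
        _ = i * τ := by rw [Finset.sum_const, Finset.card_range, nsmul_eq_mul]
        _ ≤ m * τ := mul_le_mul_of_nonneg_right (by exact_mod_cast hi'.le) hτ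
    calc ∑ i ∈ Finset.range m, ∑ j ∈ Finset.range i, ((A i ∩ A j).card : ℝ)
        ≤ ∑ i ∈ Finset.range m, (m : ℝ) * τ := Finset.sum_le_sum h3
      _ = (m : ℝ) ^ 2 * τ := by rw [Finset.sum_const, Finset.card_range, nsmul_eq_mul]; ring
  linarith

end Summit.AtomisticToContinuum.Crystallization.Theorems.LjLaminarWindowsSketch

end
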